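import Summits.CriticalPhenomena.PercolationContinuityZ3.Theorems.PercNearOneGluingNoHeavyLowerTailThreePointVarianceRefutation
import Summits.CriticalPhenomena.PercolationContinuityZ3.Theorems.PercNearOneGluingNoHeavyLowerTailThreePointPlusLeFive
import HarnessLib

/-!
# Corollaries of the `(3PT)` refutation: the row fails on `Fin n`, and the sharpened row `(3PT+)` fails

Support file for crux `stmt-CriticalPhenomena-4575` (`NoHeavyLowerTail`, closed), seat `prim-nh-lead-4575` gen 114
(`--supports stmt-CriticalPhenomena-4575`); companion of `…ThreePointVarianceRefutation` (`not_threePointVariance_all`, vertex type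
`VV = Fin 3 ⊕ Fin 2⁶⁴ × Fin 4`).  Since the kernel theorems of the row are stated on `Fin n` (`ThreePointVariance.threePointVariance_le_five`:
`∀ n ≤ 5, ∀ w a b c, …`), this file transports the counterexample along the equivalence `VV ≃ Fin (3 + 2⁶⁴·4)` [this work]: relabelling the vertices by an
equivalence `e` and the weights by `Sym2.map e.symm` preserves every `openConn` probability (`real_relabel`, from the transport file's
`prodBernoulli_real_preimage_comapConf` and `openGraph_reachable_iff_comap`), hence
`not_threePointVariance_all_fin : ¬ ∀ n (w : Sym2 (Fin n) → unitInterval) a b c, a ≠ b → a ≠ c → b ≠ c → P(a↔b)·P(a↮b) ≤ …`.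
Second corollary [this work]: the SHARPENED row `(3PT+)  x(1−x) ≤ t + u + 2xs` of `…ThreePointPlusLeFive` (kernel theorem for `n ≤ 5`;
`threePointVariance_of_plus`: it implies `(3PT)` graph by graph) fails for the same graph: `not_threePointPlus_all`.
No named facts, no sorries, standard axioms.
-/

namespace Summit.CriticalPhenomena.PercolationContinuityZ3.Theorems.ThreePointVarianceRefutation

open MeasureTheory Set Literature.Probability.Percolation Literature.Probability.LatticeModels

/-! ## Relabelling a weighted graph along an equivalence -/

section Relabel

variable {V W : Type*} (e : V ≃ W) (w : Sym2 V → unitInterval)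

/-- Pulling back along `Sym2.map e` after pulling back along `Sym2.map e.symm` is the identity. [this work] -/
theorem comapConf_comapConf_symm (ω : Set (Sym2 V)) :
    comapConf (Sym2.map e) (comapConf (Sym2.map e.symm) ω) = ω := by
  ext s
  induction s using Sym2.ind with
  | h p q => simp [mem_comapConf, Sym2.map_mk]

/-- Every pair of `W` is the image of a pair of `V`. [this work] -/
theorem range_sym2Map_equiv : Set.range (Sym2.map e) = Set.univ := by
  refine Set.eq_univ_of_forall fun s => ?_
  induction s using Sym2.ind with
  | h p q => exact ⟨s(e.symm p, e.symm q), by rw [Sym2.map_mk, Equiv.apply_symm_apply, Equiv.apply_symm_apply]⟩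

/-- **The connection event pulls back to the connection event**: `ω ↦ (Sym2.map e.symm)⁻¹' ω` maps `{x ↔ y}` onto `{e x ↔ e y}`. [this work] -/
theorem preimage_openConn (x y : V) :
    comapConf (Sym2.map e.symm) ⁻¹' (openConn (e x) (e y) : Set (BondConfig W)) = openConn x y := by
  ext ω
  rw [Set.mem_preimage]
  show (openGraph (comapConf (Sym2.map e.symm) ω)).Reachable (e x) (e y) ↔ (openGraph ω).Reachable x y
  have h := openGraph_reachable_iff_comap e.injective (F := Set.univ) (by rw [range_sym2Map_equiv]) (comapConf (Sym2.map e.symm) ω) x y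
  rw [Set.inter_univ, Set.preimage_univ, Set.inter_univ, comapConf_comapConf_symm] at h
  exact h

/-- **Relabelling invariance of `openConn`-event probabilities** (for the five events of the row). [this work] -/
theorem real_relabel [Fintype W] (E : Set (BondConfig V)) (E' : Set (BondConfig W)) (hE : comapConf (Sym2.map e.symm) ⁻¹' E' = E) :
    (prodBernoulli (w ∘ Sym2.map e.symm)).real E' = (prodBernoulli w).real E := by
  rw [← hE, prodBernoulli_real_preimage_comapConf w (Sym2.map.injective e.symm.injective) MeasurableSet.of_discrete]

end Relabel

/-! ## The counterexample on `Fin (3 + 2⁶⁴·4)` -/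

/-- The relabelling `VV ≃ Fin (3 + 2⁶⁴·4)`. [this work] -/
def eqv : VV ≃ Fin (3 + 18446744073709551616 * 4) :=
  (Equiv.sumCongr (Equiv.refl (Fin 3)) finProdFinEquiv).trans finSumFinEquiv

/-- The relabelled weights. [this work] -/
noncomputable def wtFin : Sym2 (Fin (3 + 18446744073709551616 * 4)) → unitInterval := wt ∘ Sym2.map eqv.symm

/-- **`(3PT)` fails for the relabelled graph on `Fin (3 + 2⁶⁴·4)`.** [this work] -/
theorem threePointVariance_fails_fin :
    (prodBernoulli wtFin).real (openConn (eqv ta) (eqv tb) ∩ (openConn (eqv ta) (eqv tc))ᶜ) +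
        (prodBernoulli wtFin).real (openConn (eqv ta) (eqv tc) ∩ (openConn (eqv ta) (eqv tb))ᶜ) +
        (prodBernoulli wtFin).real (openConn (eqv tb) (eqv tc) ∩ (openConn (eqv ta) (eqv tb))ᶜ) <
      (prodBernoulli wtFin).real (openConn (eqv ta) (eqv tb)) * (prodBernoulli wtFin).real (openConn (eqv ta) (eqv tb))ᶜ := by
  have h1 := preimage_openConn eqv ta tb
  have h2 := preimage_openConn eqv ta tc
  have h3 := preimage_openConn eqv tb tc
  unfold wtFin
  rw [real_relabel eqv wt (openConn ta tb ∩ (openConn ta tc)ᶜ) _ (by rw [Set.preimage_inter, Set.preimage_compl, h1, h2]),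
    real_relabel eqv wt (openConn ta tc ∩ (openConn ta tb)ᶜ) _ (by rw [Set.preimage_inter, Set.preimage_compl, h1, h2]),
    real_relabel eqv wt (openConn tb tc ∩ (openConn ta tb)ᶜ) _ (by rw [Set.preimage_inter, Set.preimage_compl, h1, h3]),
    real_relabel eqv wt (openConn ta tb) _ h1,
    real_relabel eqv wt (openConn ta tb)ᶜ _ (by rw [Set.preimage_compl, h1])]
  exact threePointVariance_fails

/-- **The three-point variance row is not valid on all `Fin n` either**: the literal all-`n` generalisation of
`ThreePointVariance.threePointVariance_le_five`'s conclusion fails at `n = 3 + 2⁶⁴·4`. [this work] -/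
theorem not_threePointVariance_all_fin :
    ¬ ∀ (n : ℕ) (w : Sym2 (Fin n) → unitInterval) (a b c : Fin n), a ≠ b → a ≠ c → b ≠ c →
      (prodBernoulli w).real (openConn a b) * (prodBernoulli w).real (openConn a b)ᶜ ≤
        (prodBernoulli w).real (openConn a b ∩ (openConn a c)ᶜ) + (prodBernoulli w).real (openConn a c ∩ (openConn a b)ᶜ) +
          (prodBernoulli w).real (openConn b c ∩ (openConn a b)ᶜ) := by
  intro h
  have hab : eqv ta ≠ eqv tb := fun h' => ta_ne_tb (eqv.injective h')
  have hac : eqv ta ≠ eqv tc := fun h' => ta_ne_tc (eqv.injective h')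
  have hbc : eqv tb ≠ eqv tc := fun h' => tb_ne_tc (eqv.injective h')
  exact absurd (h _ wtFin (eqv ta) (eqv tb) (eqv tc) hab hac hbc) (not_le.2 threePointVariance_fails_fin)

/-! ## The sharpened row `(3PT+)` fails too -/

/-- **`(3PT+)` is not valid for all finite weighted graphs**: since `(3PT+) ⟹ (3PT)` graph by graph
(`ThreePointPlus.threePointVariance_of_plus`), the counterexample to `(3PT)` violates `(3PT+)`
`P(abc)·P(¬abc) ≤ P(ac,a↮b) + P(bc,a↮b) + 2·P(abc)·P(ab,a↮c)` (the shape of `ThreePointPlus.threePointPlus_le_five`). [this work] -/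
theorem not_threePointPlus_all :
    ¬ ∀ (V : Type) [Fintype V] [DecidableEq V] (w : Sym2 V → unitInterval) (a b c : V), a ≠ b → a ≠ c → b ≠ c →
      (prodBernoulli w).real (openConn a b ∩ openConn a c) * (prodBernoulli w).real (openConn a b ∩ openConn a c)ᶜ ≤
        (prodBernoulli w).real (openConn a c ∩ (openConn a b)ᶜ) + (prodBernoulli w).real (openConn b c ∩ (openConn a b)ᶜ) +
          2 * (prodBernoulli w).real (openConn a b ∩ openConn a c) * (prodBernoulli w).real (openConn a b ∩ (openConn a c)ᶜ) := by
  intro h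
  have hplus := h VV wt ta tb tc ta_ne_tb ta_ne_tc tb_ne_tc
  have hx : (prodBernoulli wt).real (openConn ta tb) =
      (prodBernoulli wt).real (openConn ta tb ∩ openConn ta tc) + (prodBernoulli wt).real (openConn ta tb ∩ (openConn ta tc)ᶜ) := by
    rw [← measureReal_inter_add_sdiff (μ := prodBernoulli wt) (s := openConn ta tb) (t := openConn ta tc) MeasurableSet.of_discrete,
      Set.sdiff_eq]
  have hc : (prodBernoulli wt).real (openConn ta tb)ᶜ = 1 - (prodBernoulli wt).real (openConn ta tb) :=
    probReal_compl_eq_one_sub MeasurableSet.of_discrete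
  have hxc : (prodBernoulli wt).real (openConn ta tb ∩ openConn ta tc)ᶜ = 1 - (prodBernoulli wt).real (openConn ta tb ∩ openConn ta tc) :=
    probReal_compl_eq_one_sub MeasurableSet.of_discrete
  rw [hxc] at hplus
  have h3 := ThreePointPlus.threePointVariance_of_plus hplus
  have hf := threePointVariance_fails
  rw [hc, hx] at hf
  nlinarith [h3, hf]

end Summit.CriticalPhenomena.PercolationContinuityZ3.Theorems.ThreePointVarianceRefutation
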